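import Literature.LinearAlgebra.Matrix.QInversiveNonsingularBlocks
import Literature.LinearAlgebra.Matrix.QInversiveCompanion
import Mathlib.LinearAlgebra.Semisimple
import Mathlib.LinearAlgebra.Matrix.Charpoly.Minpoly
import Mathlib.LinearAlgebra.Charpoly.Basic
import Mathlib.FieldTheory.Perfect
import Mathlib.Algebra.Polynomial.Expand
import HarnessLib

/-!
# Goresky–Tai 2017, Lemma 12, the semisimplicity clauses: for a `q`-inversive `γ = (A B; C ᵗA)`,
# `γ` semisimple ⟹ `A` semisimple; conversely `A` semisimple with `B, C` nonsingular ⟹ `γ` semisimple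

Topic `Literature/LinearAlgebra/Matrix`; THEOREMS ONLY (no definition, no instance, no named fact; D-0026 net
debt 0).  Lane `lit-hodgefound` (summit `HodgeConjecture`, Track 2 foundations library), seat
`lit-hodgefound-p15`, generation 56, row g56-#8; sequel of `QInversiveNonsingularBlocks` (g56-#6: Lemma 12
(1) ⟺ (2)), `QInversiveEigenvalueBound` (g56-#7: (4.3)) and `QInversiveCompanion` (g56-#4: the completion (4.4)).

THE PRINT.  M. Goresky, Y.-S. Tai, *Real structures on ordinary Abelian varieties*, arXiv:1701.07742
[GoreskyTai2017RealStructuresOrdinary], §4.1 (p0011).  A `q`-inversive element is by definition SEMISIMPLE with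
multiplier `q` and `τ₀γτ₀⁻¹ = qγ⁻¹`; Lemma 12, after the equivalence (1) ⟺ (2), continues verbatim:

> If these properties hold then the matrix `A` is semisimple, and the characteristic polynomial of `A` is `h(2x)`,
> where `h(x)` is the real counterpart … to `p(x)`, the characteristic polynomial of `γ`. If `p(x)` is also a
> Weil `q`-polynomial then every eigenvalue `β` of `A` satisfies `|β| < √q` (4.3).
> Conversely, let `A ∈ GL_n(ℚ)` be semisimple and suppose that its eigenvalues `β₁, ⋯, βₙ` (not necessarily
> distinct) are totally real and that `|β_r| < √q` for `1 ≤ r ≤ n`. Then for any symmetric nonsingular matrix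
> `C ∈ GL_n(ℚ)` such that `ᵗAC = CA`, the following element `γ = (A, (A² − qI)C⁻¹; C, ᵗA) ∈ GSp_{2n}(ℚ)` (4.4)
> is `q`-inversive and its eigenvalues, `α_r = β_r ± √(β_r² − q)` (`1 ≤ r ≤ n`), are Weil `q`-numbers.
> *Proof.* … (a) `τ₀(w)` is an eigenvector of `γ` with eigenvalue `q/λ` (b) `u` is an eigenvector of `A` with
> eigenvalue `½(λ + q/λ)` … Since `γ` is semisimple, points (a) and (b) above imply that `A` is semisimple and
> that its characteristic polynomial is `h(2x)`.

WHAT IS HERE.  «Semisimple» for a square matrix `M` over a field `K` is the tree's (and Mathlib's)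
`Module.End.IsSemisimple (Matrix.toLin' M)` (`Module.End.IsSemisimple`; e.g. `LatimerMacDuffeeSemisimple`).  The printed
eigenvector bookkeeping (a)(b) is replaced by the polynomial identities `γ·D = D·γ = γ² + q·1` for
`D = diag(2A, 2ᵗA)` (so `D = γ + qγ⁻¹ ∈ K[γ]`) and `(2γ − D)² = D² − 4q·1`:
* §1 endomorphisms of a finite-dimensional `K`-space: `exists_aeval_mul_eq_one` (an injective endomorphism has a
  polynomial inverse), `isSemisimple_of_mul_eq` (`f` semisimple injective, `f·d = f² + q` ⟹ `d ∈ K[f]` is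
  semisimple), `isSemisimple_of_mul_self_eq` (perfect `K`, `2 ≠ 0`: `u² = e` with `e` semisimple and
  injective ⟹ `u` semisimple — `m_e(X²)` is separable).
* §2 matrices: `aeval_toLin'`, `isSemisimple_toLin'_iff` (semisimple ⟺ killed by a square-free polynomial),
  `aeval_fromBlocks_zero_zero`, `aeval_transpose`, `isSemisimple_toLin'_transpose_iff`,
  `isSemisimple_of_fromBlocks_zero_zero` ∕ `isSemisimple_fromBlocks_zero_zero_of_aeval_eq_zero` ∕
  `isSemisimple_fromBlocks_self_transpose`, `isSemisimple_toLin'_smul_iff`, `isSemisimple_toLin'_add_self_iff`,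
  `toLin'_injective_of_det_ne_zero`.
* §3 the `q`-inversive identities over a commutative ring (`diag_mul_eq`, `mul_diag_comm`,
  `two_smul_sub_diag_mul_self`, `two_smul_sub_diag_mul`, `two_smul_sub_diag_comm`) and LEMMA 12's clauses over
  a field with `2 ≠ 0`, `q ≠ 0`: **`isSemisimple_A`** ∕ `isSemisimple_A_transpose` («`γ` semisimple ⟹ `A`
  semisimple» — conditions (1)/(2) are not needed), **`isSemisimple_of_isSemisimple_A`** (perfect `K`: `A`
  semisimple and `B, C` nonsingular ⟹ `γ` semisimple), `isSemisimple_iff_isSemisimple_A`, the converse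
  construction (4.4)
  **`isSemisimple_completion_left`** (`A` semisimple, `det(A² − q) ≠ 0`, `C` symmetric nonsingular with
  `ᵗAC = CA` ⟹ `(A, (A² − qI)C⁻¹; C, ᵗA)` semisimple; its `q`-inversive relations are
  `QInversiveCompanion.completion_relations_left`), and over `ℂ` with the printed hypothesis `|β_r| < √q`:
  `det_mul_self_sub_ne_zero_of_eigenvalues`, **`isSemisimple_completion_left_of_eigenvalues`** (its eigenvalues
  are Weil `q`-numbers by `QInversiveEigenvalueBound.weil_no_real_roots_of_eigenvalues`).

NOT here: «the characteristic polynomial of `A` is `h(2x)`» holds only up to the factor `2ⁿ` (both sides monic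
is impossible); its correct forms are `QInversiveCharpoly.charpoly_eq_transform_charpoly_two_smul`
(`p_γ = 𝒯_q(p_{2A})`, i.e. `h = p_{2A}`) and `QInversiveEigenvalueBound.eval_charpoly_add_self`
(`p_{2A}(2β) = 2ⁿ p_A(β)`).

## References
* [GoreskyTai2017RealStructuresOrdinary] M. Goresky, Y.-S. Tai, Real structures on ordinary Abelian varieties,
  arXiv:1701.07742 (2017), §4.1, definition of `q`-inversive («semisimple, has multiplier q and τ₀γτ₀⁻¹ = qγ⁻¹»)
  and Lemma 12 with proof (p0011).
-/

open Matrix Polynomial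

namespace Literature.LinearAlgebra.Matrix.QInversiveSemisimple

/-! ## §1 Endomorphisms of a finite-dimensional space -/

section End

variable {K : Type*} [Field K] {V : Type*} [AddCommGroup V] [Module K V] [FiniteDimensional K V]

/-- An injective endomorphism `f` of a finite-dimensional space has a polynomial two-sided inverse `r(f)`
(`r = −m(0)⁻¹ · (m − m(0))/X` for the minimal polynomial `m`). [cite: GoreskyTai2017RealStructuresOrdinary, §4.1 «τ₀ γ τ₀⁻¹ = q γ⁻¹» (γ⁻¹ as a polynomial in γ) (p0011)] -/
theorem exists_aeval_mul_eq_one {f : Module.End K V} (hf : Function.Injective f) :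
    ∃ r : K[X], f * aeval f r = 1 ∧ aeval f r * f = 1 := by
  have hc : (minpoly K f).coeff 0 ≠ 0 := LinearMap.minpoly_coeff_zero_of_injective hf
  have h0 : f * aeval f (minpoly K f).divX + algebraMap K (Module.End K V) ((minpoly K f).coeff 0) = 0 := by
    have h := minpoly.aeval K f
    conv_lhs at h => rw [← X_mul_divX_add (minpoly K f)]
    rwa [map_add, map_mul, aeval_X, aeval_C] at h
  have hcomm : aeval f (minpoly K f).divX * f = f * aeval f (minpoly K f).divX := by
    have h1 : aeval f ((minpoly K f).divX * X) = aeval f (X * (minpoly K f).divX) := by rw [mul_comm]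
    rwa [map_mul, map_mul, aeval_X] at h1
  have hneg : f * aeval f (minpoly K f).divX = -algebraMap K (Module.End K V) ((minpoly K f).coeff 0) :=
    eq_neg_of_add_eq_zero_left h0
  refine ⟨(-((minpoly K f).coeff 0)⁻¹) • (minpoly K f).divX, ?_, ?_⟩
  · rw [map_smul, mul_smul_comm, hneg, smul_neg, neg_smul, neg_neg, Algebra.algebraMap_eq_smul_one, smul_smul,
      inv_mul_cancel₀ hc, one_smul]
  · rw [map_smul, smul_mul_assoc, hcomm, hneg, smul_neg, neg_smul, neg_neg, Algebra.algebraMap_eq_smul_one,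
      smul_smul, inv_mul_cancel₀ hc, one_smul]

/-- If `f` is semisimple and injective and `f·d = f² + q·1` then `d = f + q f⁻¹ ∈ K[f]` is semisimple.
[cite: GoreskyTai2017RealStructuresOrdinary, §4.1 proof of Lemma 12 «Since γ is semisimple, points (a) and (b) above imply that A is semisimple» (p0011)] -/
theorem isSemisimple_of_mul_eq {f d : Module.End K V} (hf : f.IsSemisimple) (hinj : Function.Injective f)
    {q : K} (h : f * d = f * f + q • (1 : Module.End K V)) : d.IsSemisimple := by
  obtain ⟨r, -, hr⟩ := exists_aeval_mul_eq_one hinj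
  have hd : d = aeval f r * (f * f + q • (1 : Module.End K V)) := by
    rw [← h, ← mul_assoc, hr, one_mul]
  rw [hd]
  exact hf.of_mem_adjoin_singleton (mul_mem (Polynomial.aeval_mem_adjoin_singleton K f)
    (add_mem (mul_mem (Algebra.self_mem_adjoin_singleton K f) (Algebra.self_mem_adjoin_singleton K f))
      (Subalgebra.smul_mem _ (one_mem _) q)))

/-- Over a perfect field with `2 ≠ 0`: if `u² = e` with `e` semisimple and injective then `u` is semisimple
(`u` is killed by `m_e(X²)`, which is separable since `m_e` is separable with `m_e(0) ≠ 0`).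
[cite: GoreskyTai2017RealStructuresOrdinary, §4.1 Lemma 12, converse «the following element γ … is q-inversive» (semisimplicity of (4.4)) (p0011)] -/
theorem isSemisimple_of_mul_self_eq [PerfectField K] (h2 : (2 : K) ≠ 0) {u e : Module.End K V}
    (he : e.IsSemisimple) (hinj : Function.Injective e) (hu : u * u = e) : u.IsSemisimple := by
  have hsep : (minpoly K e).Separable := PerfectField.separable_iff_squarefree.mpr he.minpoly_squarefree
  have hc : (minpoly K e).coeff 0 ≠ 0 := LinearMap.minpoly_coeff_zero_of_injective hinj
  have hkill : aeval u (expand K 2 (minpoly K e)) = 0 := by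
    rw [expand_aeval, pow_two, hu]; exact minpoly.aeval K e
  refine Module.End.isSemisimple_of_squarefree_aeval_eq_zero (Separable.squarefree ?_) hkill
  have h1 : IsCoprime (expand K 2 (minpoly K e)) (expand K 2 (derivative (minpoly K e))) := by
    obtain ⟨a, b, hab⟩ := (separable_def _).mp hsep
    exact ⟨expand K 2 a, expand K 2 b, by rw [← map_mul, ← map_mul, ← map_add, hab, map_one]⟩
  have hX : IsCoprime (expand K 2 (minpoly K e)) X := by
    refine (irreducible_X.coprime_iff_not_dvd.mpr ?_).symm
    rw [X_dvd_iff, coeff_expand two_pos, if_pos (dvd_zero 2), Nat.zero_div]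
    exact hc
  have hC : IsCoprime (expand K 2 (minpoly K e)) (C (2 : K)) :=
    ⟨0, C 2⁻¹, by rw [zero_mul, zero_add, ← map_mul, inv_mul_cancel₀ h2, map_one]⟩
  have hd : derivative (expand K 2 (minpoly K e)) = expand K 2 (derivative (minpoly K e)) * (C 2 * X) := by
    rw [derivative_expand]
    congr 1
    have h21 : (2 : ℕ) - 1 = 1 := rfl
    rw [h21, pow_one, Nat.cast_ofNat, ← map_ofNat C 2]
  rw [separable_def, hd]
  exact h1.mul_right (hC.mul_right hX)

end End

/-! ## §2 Matrices: semisimplicity through square-free annihilating polynomials -/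

section Bridge

variable {R : Type*} [CommRing R] {n : Type*} [Fintype n] [DecidableEq n]

/-- `Matrix.toLinAlgEquiv'` and `Matrix.toLin'` agree. [folklore] -/
private theorem toLinAlgEquiv'_eq (M : Matrix n n R) : Matrix.toLinAlgEquiv' M = Matrix.toLin' M := rfl

/-- `toLin'` is multiplicative (as `Module.End` multiplication). [folklore] -/
private theorem toLin'_mul' (M N : Matrix n n R) :
    Matrix.toLin' (M * N) = Matrix.toLin' M * Matrix.toLin' N := by
  rw [Matrix.toLin'_mul]; rfl

/-- `p(toLin' M) = toLin' (p(M))`. [cite: GoreskyTai2017RealStructuresOrdinary, §4.1 Lemma 12 «A is semisimple» (matrix ↔ endomorphism) (p0011)] -/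
theorem aeval_toLin' (M : Matrix n n R) (p : R[X]) : aeval (Matrix.toLin' M) p = Matrix.toLin' (aeval M p) := by
  rw [← toLinAlgEquiv'_eq, ← toLinAlgEquiv'_eq]
  exact aeval_algHom_apply Matrix.toLinAlgEquiv' M p

/-- `p(diag(A, D)) = diag(p(A), p(D))`. [cite: GoreskyTai2017RealStructuresOrdinary, §4.1 proof of Lemma 12 (b)(c) (A and ᵗA act on the two blocks) (p0011)] -/
theorem aeval_fromBlocks_zero_zero {m : Type*} [Fintype m] [DecidableEq m] (A : Matrix m m R) (D : Matrix n n R)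
    (p : R[X]) : aeval (fromBlocks A 0 0 D) p = fromBlocks (aeval A p) 0 0 (aeval D p) := by
  refine Polynomial.induction_on' p (fun p q hp hq => ?_) (fun k a => ?_)
  · simp only [map_add, hp, hq, fromBlocks_add, add_zero]
  · simp only [aeval_monomial, fromBlocks_diagonal_pow, Algebra.algebraMap_eq_smul_one, smul_mul_assoc, one_mul,
      fromBlocks_smul, smul_zero]

/-- `p(ᵗA) = ᵗ(p(A))`. [cite: GoreskyTai2017RealStructuresOrdinary, §4.1 proof of Lemma 12 (c) «v is an eigenvector of ᵗA with eigenvalue ½(λ + q/λ)» (p0011)] -/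
theorem aeval_transpose (A : Matrix n n R) (p : R[X]) : aeval Aᵀ p = (aeval A p)ᵀ := by
  refine Polynomial.induction_on' p (fun p q hp hq => ?_) (fun k a => ?_)
  · rw [map_add, map_add, hp, hq, transpose_add]
  · simp only [aeval_monomial, Algebra.algebraMap_eq_smul_one, smul_mul_assoc, one_mul, transpose_smul,
      transpose_pow]

variable {K : Type*} [Field K]

/-- A square matrix over a field is semisimple iff it is killed by a square-free polynomial.
[cite: GoreskyTai2017RealStructuresOrdinary, §4.1 «q-inversive if it is semisimple, has multiplier q and τ₀γτ₀⁻¹ = qγ⁻¹» (p0011)] -/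
theorem isSemisimple_toLin'_iff (M : Matrix n n K) :
    Module.End.IsSemisimple (Matrix.toLin' M) ↔ ∃ s : K[X], Squarefree s ∧ aeval M s = 0 := by
  constructor
  · intro h
    refine ⟨minpoly K M, ?_, minpoly.aeval K M⟩
    rw [← Matrix.minpoly_toLin']
    exact h.minpoly_squarefree
  · rintro ⟨s, hs, h0⟩
    exact Module.End.isSemisimple_of_squarefree_aeval_eq_zero hs (by rw [aeval_toLin', h0, map_zero])

/-- `ᵗA` is semisimple iff `A` is. [cite: GoreskyTai2017RealStructuresOrdinary, §4.1 proof of Lemma 12 (b)(c) (p0011)] -/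
theorem isSemisimple_toLin'_transpose_iff (A : Matrix n n K) :
    Module.End.IsSemisimple (Matrix.toLin' Aᵀ) ↔ Module.End.IsSemisimple (Matrix.toLin' A) := by
  rw [isSemisimple_toLin'_iff, isSemisimple_toLin'_iff]
  refine exists_congr fun s => and_congr_right fun _ => ?_
  rw [aeval_transpose]
  exact ⟨fun h => by rw [← transpose_transpose (aeval A s), h, transpose_zero],
    fun h => by rw [h, transpose_zero]⟩

/-- If `diag(A, D)` is semisimple then so are `A` and `D`. [cite: GoreskyTai2017RealStructuresOrdinary, §4.1 proof of Lemma 12 «points (a) and (b) above imply that A is semisimple» (p0011)] -/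
theorem isSemisimple_of_fromBlocks_zero_zero {m : Type*} [Fintype m] [DecidableEq m] {A : Matrix m m K}
    {D : Matrix n n K} (h : Module.End.IsSemisimple (Matrix.toLin' (fromBlocks A 0 0 D))) :
    Module.End.IsSemisimple (Matrix.toLin' A) ∧ Module.End.IsSemisimple (Matrix.toLin' D) := by
  obtain ⟨s, hs, h0⟩ := (isSemisimple_toLin'_iff _).mp h
  rw [aeval_fromBlocks_zero_zero, ← fromBlocks_zero, fromBlocks_inj] at h0
  exact ⟨(isSemisimple_toLin'_iff A).mpr ⟨s, hs, h0.1⟩, (isSemisimple_toLin'_iff D).mpr ⟨s, hs, h0.2.2.2⟩⟩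

/-- If one square-free polynomial kills both `A` and `D` then `diag(A, D)` is semisimple. [cite: GoreskyTai2017RealStructuresOrdinary, §4.1 Lemma 12, converse (p0011)] -/
theorem isSemisimple_fromBlocks_zero_zero_of_aeval_eq_zero {m : Type*} [Fintype m] [DecidableEq m]
    {A : Matrix m m K} {D : Matrix n n K} {s : K[X]} (hs : Squarefree s) (hA : aeval A s = 0)
    (hD : aeval D s = 0) : Module.End.IsSemisimple (Matrix.toLin' (fromBlocks A 0 0 D)) :=
  (isSemisimple_toLin'_iff _).mpr ⟨s, hs, by rw [aeval_fromBlocks_zero_zero, hA, hD, fromBlocks_zero]⟩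

/-- `A` semisimple ⟹ `diag(A, ᵗA)` semisimple. [cite: GoreskyTai2017RealStructuresOrdinary, §4.1 Lemma 12, converse (p0011)] -/
theorem isSemisimple_fromBlocks_self_transpose {A : Matrix n n K} (hA : Module.End.IsSemisimple (Matrix.toLin' A)) :
    Module.End.IsSemisimple (Matrix.toLin' (fromBlocks A 0 0 Aᵀ)) := by
  obtain ⟨s, hs, h0⟩ := (isSemisimple_toLin'_iff A).mp hA
  exact isSemisimple_fromBlocks_zero_zero_of_aeval_eq_zero hs h0 (by rw [aeval_transpose, h0, transpose_zero])

/-- `cM` is semisimple iff `M` is (`c ≠ 0`). [cite: GoreskyTai2017RealStructuresOrdinary, §4.1 Lemma 12 (the factor ½ in ½(λ + q/λ)) (p0011)] -/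
theorem isSemisimple_toLin'_smul_iff {c : K} (hc : c ≠ 0) (M : Matrix n n K) :
    Module.End.IsSemisimple (Matrix.toLin' (c • M)) ↔ Module.End.IsSemisimple (Matrix.toLin' M) := by
  rw [map_smul]
  exact Module.End.IsSemisimple_smul_iff hc

/-- `2M = M + M` is semisimple iff `M` is (`2 ≠ 0`). [cite: GoreskyTai2017RealStructuresOrdinary, §4.1 Lemma 12 (p0011)] -/
theorem isSemisimple_toLin'_add_self_iff (h2 : (2 : K) ≠ 0) (M : Matrix n n K) :
    Module.End.IsSemisimple (Matrix.toLin' (M + M)) ↔ Module.End.IsSemisimple (Matrix.toLin' M) := by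
  rw [← two_smul K M, isSemisimple_toLin'_smul_iff h2]

/-- A matrix with nonzero determinant acts injectively. [folklore] -/
private theorem toLin'_injective_of_det_ne_zero {M : Matrix n n K} (h : M.det ≠ 0) :
    Function.Injective (Matrix.toLin' M) := by
  have hinj : Function.Injective M.mulVec :=
    Matrix.mulVec_injective_iff_isUnit.mpr ((Matrix.isUnit_iff_isUnit_det M).mpr (Ne.isUnit h))
  intro v w hvw
  exact hinj (by simpa only [Matrix.toLin'_apply] using hvw)

end Bridge

/-! ## §3 The `q`-inversive element: `γ·D = D·γ = γ² + q·1`, `(2γ − D)² = D² − 4q·1` -/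

section CommRing

variable {R : Type*} [CommRing R] {m : Type*} [Fintype m] [DecidableEq m]

/-- `D·γ = γ² + q·1` for `D = diag(A + A, ᵗA + ᵗA)` (companion of `QInversiveNonsingularBlocks.sq_add_smul_one_eq`:
`γ·D = γ² + q·1`). [cite: GoreskyTai2017RealStructuresOrdinary, §4.1 proof of Lemma 12 (b)(c) (p0011)] -/
theorem diag_mul_eq {A B C : Matrix m m R} {q : R} (hB : Bᵀ = B) (hC : Cᵀ = C) (hAB : A * B = B * Aᵀ)
    (hCA : C * A = Aᵀ * C) (hq : A * A - B * C = q • (1 : Matrix m m R)) :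
    fromBlocks (A + A) 0 0 (Aᵀ + Aᵀ) * fromBlocks A B C Aᵀ =
      fromBlocks A B C Aᵀ * fromBlocks A B C Aᵀ + q • (1 : Matrix (m ⊕ m) (m ⊕ m) R) := by
  have hsum : fromBlocks (A + A) 0 0 (Aᵀ + Aᵀ) = fromBlocks A B C Aᵀ + fromBlocks A (-B) (-C) Aᵀ := by
    rw [fromBlocks_add]; congr 1 <;> abel
  rw [hsum, Matrix.add_mul, QInversiveCharpoly.tau0Conj_mul_eq_smul_one hB hC hAB hCA hq]

/-- `γ·D = D·γ`. [cite: GoreskyTai2017RealStructuresOrdinary, §4.1 proof of Lemma 12 (p0011)] -/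
theorem mul_diag_comm {A B C : Matrix m m R} {q : R} (hB : Bᵀ = B) (hC : Cᵀ = C) (hAB : A * B = B * Aᵀ)
    (hCA : C * A = Aᵀ * C) (hq : A * A - B * C = q • (1 : Matrix m m R)) :
    fromBlocks A B C Aᵀ * fromBlocks (A + A) 0 0 (Aᵀ + Aᵀ) =
      fromBlocks (A + A) 0 0 (Aᵀ + Aᵀ) * fromBlocks A B C Aᵀ := by
  rw [← QInversiveNonsingularBlocks.sq_add_smul_one_eq hB hC hAB hCA hq, diag_mul_eq hB hC hAB hCA hq]

/-- `(2γ − D)² = D² − 4q·1`. [cite: GoreskyTai2017RealStructuresOrdinary, §4.1 Lemma 12 (4.5) «α_r = β_r ± √(β_r² − q)» (i.e. (α − β)² = β² − q with 2β = λ + q/λ) (p0011)] -/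
theorem two_smul_sub_diag_mul_self {A B C : Matrix m m R} {q : R} (hB : Bᵀ = B) (hC : Cᵀ = C)
    (hAB : A * B = B * Aᵀ) (hCA : C * A = Aᵀ * C) (hq : A * A - B * C = q • (1 : Matrix m m R)) :
    ((2 : R) • fromBlocks A B C Aᵀ - fromBlocks (A + A) 0 0 (Aᵀ + Aᵀ)) *
        ((2 : R) • fromBlocks A B C Aᵀ - fromBlocks (A + A) 0 0 (Aᵀ + Aᵀ)) =
      fromBlocks (A + A) 0 0 (Aᵀ + Aᵀ) * fromBlocks (A + A) 0 0 (Aᵀ + Aᵀ) -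
        (4 * q) • (1 : Matrix (m ⊕ m) (m ⊕ m) R) := by
  have h1 := QInversiveNonsingularBlocks.sq_add_smul_one_eq hB hC hAB hCA hq
  have h2 := diag_mul_eq hB hC hAB hCA hq
  have hexp : ((2 : R) • fromBlocks A B C Aᵀ - fromBlocks (A + A) 0 0 (Aᵀ + Aᵀ)) *
        ((2 : R) • fromBlocks A B C Aᵀ - fromBlocks (A + A) 0 0 (Aᵀ + Aᵀ)) =
      (2 : R) • ((2 : R) • (fromBlocks A B C Aᵀ * fromBlocks A B C Aᵀ)) -
        (2 : R) • (fromBlocks A B C Aᵀ * fromBlocks (A + A) 0 0 (Aᵀ + Aᵀ)) -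
        (2 : R) • (fromBlocks (A + A) 0 0 (Aᵀ + Aᵀ) * fromBlocks A B C Aᵀ) +
        fromBlocks (A + A) 0 0 (Aᵀ + Aᵀ) * fromBlocks (A + A) 0 0 (Aᵀ + Aᵀ) := by
    simp only [Matrix.sub_mul, Matrix.mul_sub, Matrix.smul_mul, Matrix.mul_smul, smul_sub]
    abel
  rw [hexp, ← h1, h2]
  module

/-- `(2γ − D)·γ = γ² − q·1`. [cite: GoreskyTai2017RealStructuresOrdinary, §4.1 proof of Lemma 12 «hence BC = A² − qI is singular» (p0011)] -/
theorem two_smul_sub_diag_mul {A B C : Matrix m m R} {q : R} (hB : Bᵀ = B) (hC : Cᵀ = C)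
    (hAB : A * B = B * Aᵀ) (hCA : C * A = Aᵀ * C) (hq : A * A - B * C = q • (1 : Matrix m m R)) :
    ((2 : R) • fromBlocks A B C Aᵀ - fromBlocks (A + A) 0 0 (Aᵀ + Aᵀ)) * fromBlocks A B C Aᵀ =
      fromBlocks A B C Aᵀ * fromBlocks A B C Aᵀ - q • (1 : Matrix (m ⊕ m) (m ⊕ m) R) := by
  rw [Matrix.sub_mul, Matrix.smul_mul, diag_mul_eq hB hC hAB hCA hq]
  module

/-- `(2γ − D)·D = D·(2γ − D)`. [cite: GoreskyTai2017RealStructuresOrdinary, §4.1 proof of Lemma 12 (p0011)] -/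
theorem two_smul_sub_diag_comm {A B C : Matrix m m R} {q : R} (hB : Bᵀ = B) (hC : Cᵀ = C)
    (hAB : A * B = B * Aᵀ) (hCA : C * A = Aᵀ * C) (hq : A * A - B * C = q • (1 : Matrix m m R)) :
    ((2 : R) • fromBlocks A B C Aᵀ - fromBlocks (A + A) 0 0 (Aᵀ + Aᵀ)) * fromBlocks (A + A) 0 0 (Aᵀ + Aᵀ) =
      fromBlocks (A + A) 0 0 (Aᵀ + Aᵀ) * ((2 : R) • fromBlocks A B C Aᵀ - fromBlocks (A + A) 0 0 (Aᵀ + Aᵀ)) := by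
  rw [Matrix.sub_mul, Matrix.mul_sub, Matrix.smul_mul, Matrix.mul_smul, mul_diag_comm hB hC hAB hCA hq]

end CommRing

/-! ## §4 Lemma 12: the semisimplicity clauses -/

section Field

variable {K : Type*} [Field K] {m : Type*} [Fintype m] [DecidableEq m]

/-- **Lemma 12, «then the matrix `A` is semisimple»** (for a `q`-inversive — in particular semisimple — `γ`;
the conditions (1)/(2) of the Lemma are not needed): `γ = (A B; C ᵗA)` semisimple, `q ≠ 0`, `2 ≠ 0` ⟹ `A`
semisimple. [cite: GoreskyTai2017RealStructuresOrdinary, §4.1 Lemma 12 «If these properties hold then the matrix A is semisimple» (p0011)] -/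
theorem isSemisimple_A (h2 : (2 : K) ≠ 0) {A B C : Matrix m m K} {q : K} (hq0 : q ≠ 0) (hB : Bᵀ = B)
    (hC : Cᵀ = C) (hAB : A * B = B * Aᵀ) (hCA : C * A = Aᵀ * C) (hq : A * A - B * C = q • (1 : Matrix m m K))
    (hγ : Module.End.IsSemisimple (Matrix.toLin' (fromBlocks A B C Aᵀ))) : Module.End.IsSemisimple (Matrix.toLin' A) := by
  have hinj := toLin'_injective_of_det_ne_zero (QInversiveNonsingularBlocks.det_ne_zero hq0 hB hC hAB hCA hq)
  have hid : Matrix.toLin' (fromBlocks A B C Aᵀ) * Matrix.toLin' (fromBlocks (A + A) 0 0 (Aᵀ + Aᵀ)) =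
      Matrix.toLin' (fromBlocks A B C Aᵀ) * Matrix.toLin' (fromBlocks A B C Aᵀ) +
        q • (1 : Module.End K (m ⊕ m → K)) := by
    have h := congrArg Matrix.toLin' (QInversiveNonsingularBlocks.sq_add_smul_one_eq hB hC hAB hCA hq)
    rw [toLin'_mul', map_add, toLin'_mul', map_smul, Matrix.toLin'_one] at h
    exact h.symm
  have hD := isSemisimple_of_mul_eq hγ hinj hid
  exact (isSemisimple_toLin'_add_self_iff h2 A).mp (isSemisimple_of_fromBlocks_zero_zero hD).1

/-- … and `ᵗA` is semisimple. [cite: GoreskyTai2017RealStructuresOrdinary, §4.1 Lemma 12 (c) (p0011)] -/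
theorem isSemisimple_A_transpose (h2 : (2 : K) ≠ 0) {A B C : Matrix m m K} {q : K} (hq0 : q ≠ 0)
    (hB : Bᵀ = B) (hC : Cᵀ = C) (hAB : A * B = B * Aᵀ) (hCA : C * A = Aᵀ * C)
    (hq : A * A - B * C = q • (1 : Matrix m m K)) (hγ : Module.End.IsSemisimple (Matrix.toLin' (fromBlocks A B C Aᵀ))) :
    Module.End.IsSemisimple (Matrix.toLin' Aᵀ) :=
  (isSemisimple_toLin'_transpose_iff A).mpr (isSemisimple_A h2 hq0 hB hC hAB hCA hq hγ)

/-- **Lemma 12, converse semisimplicity** (perfect field, `2 ≠ 0`, `q ≠ 0`): if `A` is semisimple and `B`, `C` are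
nonsingular (equivalently, by (1) ⟺ (2), `γ` has no eigenvalue `±√q`; `A` is then automatically nonsingular)
then the `q`-inversive-shaped `γ = (A B; C ᵗA)` is semisimple: `D = diag(2A, 2ᵗA)` is semisimple, `u = 2γ − D`
has `u² = D² − 4q` semisimple and invertible, so `u` and `γ = ½(u + D)` are semisimple.
[cite: GoreskyTai2017RealStructuresOrdinary, §4.1 Lemma 12, converse «Then … the following element γ … is q-inversive» (p0011)] -/
theorem isSemisimple_of_isSemisimple_A [PerfectField K] (h2 : (2 : K) ≠ 0) {A B C : Matrix m m K} {q : K}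
    (hq0 : q ≠ 0) (hB : Bᵀ = B) (hC : Cᵀ = C) (hAB : A * B = B * Aᵀ) (hCA : C * A = Aᵀ * C)
    (hq : A * A - B * C = q • (1 : Matrix m m K)) (hA : Module.End.IsSemisimple (Matrix.toLin' A)) (hBd : B.det ≠ 0)
    (hCd : C.det ≠ 0) : Module.End.IsSemisimple (Matrix.toLin' (fromBlocks A B C Aᵀ)) := by
  -- `D = diag(A + A, ᵗA + ᵗA)` is semisimple
  obtain ⟨s, hs, hs0⟩ := (isSemisimple_toLin'_iff (A + A)).mp ((isSemisimple_toLin'_add_self_iff h2 A).mpr hA)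
  have hD : Module.End.IsSemisimple (Matrix.toLin' (fromBlocks (A + A) 0 0 (Aᵀ + Aᵀ))) :=
    isSemisimple_fromBlocks_zero_zero_of_aeval_eq_zero hs hs0
      (by rw [← transpose_add, aeval_transpose, hs0, transpose_zero])
  -- `e = D² − 4q·1` is semisimple and injective
  have hγ0 := QInversiveNonsingularBlocks.det_ne_zero hq0 hB hC hAB hCA hq
  have hu := two_smul_sub_diag_mul_self hB hC hAB hCA hq
  have hE : Module.End.IsSemisimple (Matrix.toLin' (fromBlocks (A + A) 0 0 (Aᵀ + Aᵀ) * fromBlocks (A + A) 0 0 (Aᵀ + Aᵀ) -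
      (4 * q) • (1 : Matrix (m ⊕ m) (m ⊕ m) K))) := by
    rw [map_sub, map_smul, toLin'_mul', Matrix.toLin'_one, ← pow_two]
    have h := (Module.End.isSemisimple_sub_algebraMap_iff (μ := 4 * q)).mpr (hD.pow 2)
    rwa [Algebra.algebraMap_eq_smul_one] at h
  have hEdet : (fromBlocks (A + A) 0 0 (Aᵀ + Aᵀ) * fromBlocks (A + A) 0 0 (Aᵀ + Aᵀ) -
      (4 * q) • (1 : Matrix (m ⊕ m) (m ⊕ m) K)).det ≠ 0 := by
    have hdet : (((2 : K) • fromBlocks A B C Aᵀ - fromBlocks (A + A) 0 0 (Aᵀ + Aᵀ))).det ≠ 0 := by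
      have h := congrArg det (two_smul_sub_diag_mul hB hC hAB hCA hq)
      rw [det_mul] at h
      intro h0
      rw [h0, zero_mul] at h
      exact ((QInversiveNonsingularBlocks.det_sq_sub_ne_zero_iff h2 hq0 hB hC hAB hCA hq).mpr ⟨hBd, hCd⟩) h.symm
    rw [← hu, det_mul]
    exact mul_ne_zero hdet hdet
  -- `u = 2γ − D` is semisimple
  have hU : Module.End.IsSemisimple (Matrix.toLin' ((2 : K) • fromBlocks A B C Aᵀ - fromBlocks (A + A) 0 0 (Aᵀ + Aᵀ))) :=
    isSemisimple_of_mul_self_eq h2 hE (toLin'_injective_of_det_ne_zero hEdet)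
      (by rw [← toLin'_mul', hu])
  -- `2γ = u + D`
  have hcomm : Commute (Matrix.toLin' ((2 : K) • fromBlocks A B C Aᵀ - fromBlocks (A + A) 0 0 (Aᵀ + Aᵀ)))
      (Matrix.toLin' (fromBlocks (A + A) 0 0 (Aᵀ + Aᵀ))) := by
    show _ * _ = _ * _
    rw [← toLin'_mul', ← toLin'_mul', two_smul_sub_diag_comm hB hC hAB hCA hq]
  have h2γ := Module.End.IsSemisimple.add_of_commute hcomm hU hD
  rw [← map_add, sub_add_cancel] at h2γ
  exact (isSemisimple_toLin'_smul_iff h2 _).mp h2γ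

/-- **Lemma 12, semisimplicity, both ways** (perfect field, `2 ≠ 0`, `q ≠ 0`, `B`, `C` nonsingular — i.e. under
condition (1) of the Lemma): `γ = (A B; C ᵗA)` is semisimple iff `A` is.
[cite: GoreskyTai2017RealStructuresOrdinary, §4.1 Lemma 12 «If these properties hold then the matrix A is semisimple» and its converse (p0011)] -/
theorem isSemisimple_iff_isSemisimple_A [PerfectField K] (h2 : (2 : K) ≠ 0) {A B C : Matrix m m K} {q : K}
    (hq0 : q ≠ 0) (hB : Bᵀ = B) (hC : Cᵀ = C) (hAB : A * B = B * Aᵀ) (hCA : C * A = Aᵀ * C)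
    (hq : A * A - B * C = q • (1 : Matrix m m K)) (hBd : B.det ≠ 0) (hCd : C.det ≠ 0) :
    Module.End.IsSemisimple (Matrix.toLin' (fromBlocks A B C Aᵀ)) ↔ Module.End.IsSemisimple (Matrix.toLin' A) :=
  ⟨isSemisimple_A h2 hq0 hB hC hAB hCA hq, fun hA => isSemisimple_of_isSemisimple_A h2 hq0 hB hC hAB hCA hq hA hBd hCd⟩

/-- **Lemma 12, the converse construction (4.4)** over a perfect field with `2 ≠ 0`, `q ≠ 0`: `A` semisimple with
`det(A² − qI) ≠ 0` (no eigenvalue `±√q`), `C` symmetric nonsingular with `ᵗAC = CA` ⟹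
`γ = (A, (A² − qI)C⁻¹; C, ᵗA)` is semisimple (and `q`-inversive: `QInversiveCompanion.completion_relations_left`,
`completion_multiplier_left`). [cite: GoreskyTai2017RealStructuresOrdinary, §4.1 Lemma 12 «Conversely, let A ∈ GL_n(ℚ) be semisimple … the following element γ = (A, (A² − qI)C⁻¹; C, ᵗA) ∈ GSp_2n(ℚ) (4.4) is q-inversive» (p0011)] -/
theorem isSemisimple_completion_left [PerfectField K] (h2 : (2 : K) ≠ 0) {A C : Matrix m m K} {q : K}
    (hq0 : q ≠ 0) (hC : Cᵀ = C) (hCd : C.det ≠ 0) (hAC : Aᵀ * C = C * A)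
    (hA : Module.End.IsSemisimple (Matrix.toLin' A)) (hAq : (A * A - q • (1 : Matrix m m K)).det ≠ 0) :
    Module.End.IsSemisimple (Matrix.toLin' (fromBlocks A ((A * A - q • (1 : Matrix m m K)) * C⁻¹) C Aᵀ)) := by
  have hCu : IsUnit C.det := (Ne.isUnit hCd)
  obtain ⟨hB, hAB, hCA, hq⟩ := QInversiveCompanion.completion_relations_left hC hCu hAC q
  refine isSemisimple_of_isSemisimple_A h2 hq0 hB hC hAB hCA hq hA ?_ hCd
  rw [det_mul]
  exact mul_ne_zero hAq (Matrix.isUnit_nonsing_inv_det_iff.mpr hCu).ne_zero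

end Field

/-! ## §5 Over `ℂ`: the printed hypothesis `|β_r| < √q` -/

section Complex

open Complex

variable {m : Type*} [Fintype m] [DecidableEq m]

/-- If every eigenvalue `β` of `A ∈ M_n(ℂ)` has `(Re β)² < q` (e.g. `β` real with `|β| < √q`) then
`det(A² − qI) ≠ 0`. [cite: GoreskyTai2017RealStructuresOrdinary, §4.1 Lemma 12 «|β_r| < √q for 1 ≤ r ≤ n» (p0011)] -/
theorem det_mul_self_sub_ne_zero_of_eigenvalues {A : Matrix m m ℂ} {q : ℝ} (hq0 : 0 < q)
    (heig : ∀ β ∈ A.charpoly.roots, β.re ^ 2 < q) : (A * A - (q : ℂ) • (1 : Matrix m m ℂ)).det ≠ 0 := by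
  have hx : ((Real.sqrt q : ℝ) : ℂ) ^ 2 = (q : ℂ) := by
    rw [← ofReal_pow, Real.sq_sqrt hq0.le]
  rw [← hx, ← QInversiveNonsingularBlocks.eval_mul_eval_neg_eq_det]
  have hne : A.charpoly ≠ 0 := (charpoly_monic A).ne_zero
  have hsq : ((Real.sqrt q : ℝ) : ℂ).re ^ 2 = q := by rw [ofReal_re, Real.sq_sqrt hq0.le]
  refine mul_ne_zero (fun h => ?_) (fun h => ?_)
  · have := heig _ ((mem_roots hne).mpr h)
    rw [hsq] at this
    exact lt_irrefl _ this
  · have := heig _ ((mem_roots hne).mpr h)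
    rw [neg_re, neg_sq, hsq] at this
    exact lt_irrefl _ this

/-- **Lemma 12, converse, as printed over `ℚ ⊂ ℂ`**: `A ∈ M_n(ℂ)` semisimple with all eigenvalues real and
`|β_r| < √q` (`q > 0`), `C` symmetric nonsingular with `ᵗAC = CA` ⟹ `γ = (A, (A² − qI)C⁻¹; C, ᵗA)` is
semisimple; it is `q`-inversive by `QInversiveCompanion.completion_relations_left` and its eigenvalues are Weil
`q`-numbers by `QInversiveEigenvalueBound.weil_no_real_roots_of_eigenvalues`.
[cite: GoreskyTai2017RealStructuresOrdinary, §4.1 Lemma 12, converse statement (4.4)–(4.5) (p0011)] -/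
theorem isSemisimple_completion_left_of_eigenvalues {A C : Matrix m m ℂ} {q : ℝ} (hq0 : 0 < q) (hC : Cᵀ = C)
    (hCd : C.det ≠ 0) (hAC : Aᵀ * C = C * A) (hA : Module.End.IsSemisimple (Matrix.toLin' A))
    (heig : ∀ β ∈ A.charpoly.roots, β.im = 0 ∧ β.re ^ 2 < q) :
    Module.End.IsSemisimple (Matrix.toLin' (fromBlocks A ((A * A - (q : ℂ) • (1 : Matrix m m ℂ)) * C⁻¹) C Aᵀ)) :=
  isSemisimple_completion_left two_ne_zero (ofReal_ne_zero.mpr hq0.ne') hC hCd hAC hA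
    (det_mul_self_sub_ne_zero_of_eigenvalues hq0 fun β hβ => (heig β hβ).2)

end Complex

end Literature.LinearAlgebra.Matrix.QInversiveSemisimple
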